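import Summits.CriticalPhenomena.PercolationContinuityZ3.Theorems.PercNearOneGluingAdditiveGluingBlockGoodLeaves
import Summits.CriticalPhenomena.PercolationContinuityZ3.Theorems.PercNearOneGluingAdditiveGluingOneBond
import HarnessLib

/-! # Crux `PercNearOneGluing.AdditiveGluing` (stmt-CriticalPhenomena-4576), residual kernel `residualKernel` — edge mixtures
# and designated-relay monotonicity of the block kernel (invested seat xfam-a)

Support file for the OPEN residual of `goodStep_of_residualKernel` (`…GoodStepResidual.lean`): the block-goodness
kernel of a glued block `S` against a designated relay `a₀` with a FIXED selection `sel`,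
`BK(u) :  μ_u(a₀ ↔ b) + μ_u(a₀ ↮ b, a₀ ↔ S, S ↔ b) ≤ μ_u(S ↔ b) + Σ_{W ∩ A = ∅} μ_u(K_S = W) · μ_u(sel W ↔ b in Wᶜ)`
(`K_S = ⋃_{s ∈ S} C(s)`), written below exactly as in the residual kernel.  Lands `--supports stmt-CriticalPhenomena-4576`;
no definitions, no named facts.

* `blockKernel_of_update` (**edge mixture**): for every pair `e`, `BK(u[e ↦ 1]) ∧ BK(u[e ↦ 0]) ⟹ BK(u)`.  Reason: with
  `sel` fixed every term of `BK` is AFFINE in the weight of `e` — the three plain probabilities by the one-bond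
  decomposition (`stub_oneBondDecomp_k15`), and each pocket product because exactly one of its two factors depends on
  `e` (`{K_S = W}` lives on the pairs meeting `W`, `{sel W ↔ b in Wᶜ}` on the pairs avoiding `W`:
  `blockPocket_determinedBy`, `offObs_determinedBy_openConnIn_compl`).  So the open residual may be checked at the two
  endpoint weightings of ANY pair, in particular of pairs far from the observer block (for pairs at a point observer this
  is the σ-decomposition of Kozma–Nitzan, arXiv:2401.12397 §3.2; for other pairs it is new in this programme and is what
  makes corner expansions of the residual legitimate).
* `blockKernel_of_zeroOne_on` : iterating over a finite set `F` of pairs, `BK(u)` follows from `BK(u')` for the `2^|F|`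
  weightings `u'` that agree with `u` off `F` and are `0/1`-valued on `F`.
* `blockKernel_mono_designated` (**initial segment**): `BK` at a designated relay `a'` implies `BK` at every `a₀` with
  `μ_{u/S}(a₀ ↔ b) ≤ μ_{u/S}(a' ↔ b)` in the GLUED weighting `u/S` (the left side of `BK` is `μ_{u/S}(a₀ ↔ b)`,
  `blockGrowth_glue_real_openConn`); this is how goodness of the glued block observed from another relay ("switching")
  closes residual instances.
[cite: KozmaNitzan2024, §3.2 (Thms 4–5, pp. 12–14) and §5.3 (p. 34: linearity in one edge weight)]
-/

namespace Summit.CriticalPhenomena.PercolationContinuityZ3.Theorems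

open MeasureTheory Set
open Literature.Probability.LatticeModels (prodBernoulli)
open Literature.Probability.Percolation (BondConfig openConn openConnIn openGraph openCluster)
open scoped BigOperators

noncomputable section
open Classical

section BlockKernelMix

open Literature.Probability.LatticeModels Literature.Probability.Percolation

variable {n : ℕ}

/-- **Edge mixture for the block kernel.**  For a non-empty block `S`, relays `A`, target `b`, designated relay `a₀`,
a fixed selection `sel` and ANY pair `e`: if the block-kernel inequality holds for the two weightings `u[e ↦ 1]` and
`u[e ↦ 0]`, it holds for `u`.  Every term is affine in the weight of `e` (one-bond decomposition; for the pocket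
products, one factor is constant in that weight by locality), and `BK(u) = (1 − u e)·BK(u[e↦0]) + (u e)·BK(u[e↦1])`
termwise. [cite: KozmaNitzan2024, §5.3 p. 34 (linearity of pre-FKG quantities in one edge weight)] -/
theorem blockKernel_of_update (u : Sym2 (Fin n) → unitInterval) (A S : Finset (Fin n)) (b a₀ : Fin n)
    (sel : Finset (Fin n) → Fin n) (e : Sym2 (Fin n)) (hS : S.Nonempty)
    (h1 : (prodBernoulli (Function.update u e 1)).real (openConn a₀ b)
        + (prodBernoulli (Function.update u e 1)).real
            ((openConn a₀ b)ᶜ ∩ (⋃ s ∈ S, openConn a₀ s) ∩ (⋃ s ∈ S, openConn s b))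
      ≤ (prodBernoulli (Function.update u e 1)).real (⋃ s ∈ S, openConn s b)
        + ∑ W ∈ (Finset.univ : Finset (Finset (Fin n))).filter (fun W => Disjoint W A),
            (prodBernoulli (Function.update u e 1)).real
                {ω : BondConfig (Fin n) | ∀ z : Fin n, (z ∈ W ↔ ω ∈ ⋃ s ∈ S, openConn s z)}
              * (prodBernoulli (Function.update u e 1)).real (openConnIn ((W : Set (Fin n))ᶜ) (sel W) b))
    (h0 : (prodBernoulli (Function.update u e 0)).real (openConn a₀ b)
        + (prodBernoulli (Function.update u e 0)).real
            ((openConn a₀ b)ᶜ ∩ (⋃ s ∈ S, openConn a₀ s) ∩ (⋃ s ∈ S, openConn s b))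
      ≤ (prodBernoulli (Function.update u e 0)).real (⋃ s ∈ S, openConn s b)
        + ∑ W ∈ (Finset.univ : Finset (Finset (Fin n))).filter (fun W => Disjoint W A),
            (prodBernoulli (Function.update u e 0)).real
                {ω : BondConfig (Fin n) | ∀ z : Fin n, (z ∈ W ↔ ω ∈ ⋃ s ∈ S, openConn s z)}
              * (prodBernoulli (Function.update u e 0)).real (openConnIn ((W : Set (Fin n))ᶜ) (sel W) b)) :
    (prodBernoulli u).real (openConn a₀ b)
        + (prodBernoulli u).real ((openConn a₀ b)ᶜ ∩ (⋃ s ∈ S, openConn a₀ s) ∩ (⋃ s ∈ S, openConn s b))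
      ≤ (prodBernoulli u).real (⋃ s ∈ S, openConn s b)
        + ∑ W ∈ (Finset.univ : Finset (Finset (Fin n))).filter (fun W => Disjoint W A),
            (prodBernoulli u).real {ω : BondConfig (Fin n) | ∀ z : Fin n, (z ∈ W ↔ ω ∈ ⋃ s ∈ S, openConn s z)}
              * (prodBernoulli u).real (openConnIn ((W : Set (Fin n))ᶜ) (sel W) b) := by
  set p : ℝ := (u e : ℝ) with hp
  set u1 : Sym2 (Fin n) → unitInterval := Function.update u e 1 with hu1
  set u0 : Sym2 (Fin n) → unitInterval := Function.update u e 0 with hu0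
  have hp0 : 0 ≤ p := unitInterval.nonneg _
  have hp1 : p ≤ 1 := unitInterval.le_one _
  -- one-bond decomposition of every plain probability
  have hdec : ∀ E : Set (BondConfig (Fin n)),
      (prodBernoulli u).real E = (1 - p) * (prodBernoulli u0).real E + p * (prodBernoulli u1).real E :=
    fun E => stub_oneBondDecomp_k15 n u e E
  -- the two weightings agree with `u` off `e`
  have hag0 : ∀ e', e' ≠ e → u e' = u0 e' := fun e' he' => by
    simp only [hu0]; rw [Function.update_of_ne he']
  have hag1 : ∀ e', e' ≠ e → u e' = u1 e' := fun e' he' => by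
    simp only [hu1]; rw [Function.update_of_ne he']
  -- each pocket product is affine
  have hW : ∀ W : Finset (Fin n),
      (prodBernoulli u).real {ω : BondConfig (Fin n) | ∀ z : Fin n, (z ∈ W ↔ ω ∈ ⋃ s ∈ S, openConn s z)}
          * (prodBernoulli u).real (openConnIn ((W : Set (Fin n))ᶜ) (sel W) b) =
        (1 - p) * ((prodBernoulli u0).real
              {ω : BondConfig (Fin n) | ∀ z : Fin n, (z ∈ W ↔ ω ∈ ⋃ s ∈ S, openConn s z)}
            * (prodBernoulli u0).real (openConnIn ((W : Set (Fin n))ᶜ) (sel W) b))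
        + p * ((prodBernoulli u1).real
              {ω : BondConfig (Fin n) | ∀ z : Fin n, (z ∈ W ↔ ω ∈ ⋃ s ∈ S, openConn s z)}
            * (prodBernoulli u1).real (openConnIn ((W : Set (Fin n))ᶜ) (sel W) b)) := by
    intro W
    by_cases he : ∃ x ∈ W, x ∈ e
    · -- `e` meets `W`: the off-`W` connection does not feel `e`
      have hoff : ∀ q : Sym2 (Fin n) → unitInterval, (∀ e', e' ≠ e → u e' = q e') →
          (prodBernoulli u).real (openConnIn ((W : Set (Fin n))ᶜ) (sel W) b) =
            (prodBernoulli q).real (openConnIn ((W : Set (Fin n))ᶜ) (sel W) b) := by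
        intro q hq
        refine prodBernoulli_real_eq_of_determinedBy u q (fun e' he' => hq e' ?_)
          (offObs_determinedBy_openConnIn_compl W (sel W) b) MeasurableSet.of_discrete
        rintro rfl
        obtain ⟨x, hxW, hxe⟩ := he
        exact (Finset.mem_filter.1 he').2 x hxe hxW
      rw [hdec {ω : BondConfig (Fin n) | ∀ z : Fin n, (z ∈ W ↔ ω ∈ ⋃ s ∈ S, openConn s z)},
        ← hoff u0 hag0, ← hoff u1 hag1]
      ring
    · -- `e` avoids `W`: the block pocket does not feel `e`
      push Not at he
      have hpk : ∀ q : Sym2 (Fin n) → unitInterval, (∀ e', e' ≠ e → u e' = q e') →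
          (prodBernoulli u).real {ω : BondConfig (Fin n) | ∀ z : Fin n, (z ∈ W ↔ ω ∈ ⋃ s ∈ S, openConn s z)} =
            (prodBernoulli q).real
              {ω : BondConfig (Fin n) | ∀ z : Fin n, (z ∈ W ↔ ω ∈ ⋃ s ∈ S, openConn s z)} := by
        intro q hq
        refine prodBernoulli_real_eq_of_determinedBy u q (fun e' he' => hq e' ?_)
          (blockPocket_determinedBy S W hS) MeasurableSet.of_discrete
        rintro rfl
        obtain ⟨x, hxW, hxe⟩ := (Finset.mem_filter.1 he').2
        exact he x hxW hxe
      rw [hdec (openConnIn ((W : Set (Fin n))ᶜ) (sel W) b), ← hpk u0 hag0, ← hpk u1 hag1]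
      ring
  have hsum : ∑ W ∈ (Finset.univ : Finset (Finset (Fin n))).filter (fun W => Disjoint W A),
        (prodBernoulli u).real {ω : BondConfig (Fin n) | ∀ z : Fin n, (z ∈ W ↔ ω ∈ ⋃ s ∈ S, openConn s z)}
          * (prodBernoulli u).real (openConnIn ((W : Set (Fin n))ᶜ) (sel W) b) =
      (1 - p) * ∑ W ∈ (Finset.univ : Finset (Finset (Fin n))).filter (fun W => Disjoint W A),
          (prodBernoulli u0).real {ω : BondConfig (Fin n) | ∀ z : Fin n, (z ∈ W ↔ ω ∈ ⋃ s ∈ S, openConn s z)}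
            * (prodBernoulli u0).real (openConnIn ((W : Set (Fin n))ᶜ) (sel W) b)
      + p * ∑ W ∈ (Finset.univ : Finset (Finset (Fin n))).filter (fun W => Disjoint W A),
          (prodBernoulli u1).real {ω : BondConfig (Fin n) | ∀ z : Fin n, (z ∈ W ↔ ω ∈ ⋃ s ∈ S, openConn s z)}
            * (prodBernoulli u1).real (openConnIn ((W : Set (Fin n))ᶜ) (sel W) b) := by
    rw [Finset.mul_sum, Finset.mul_sum, ← Finset.sum_add_distrib]
    exact Finset.sum_congr rfl fun W _ => hW W
  rw [hdec (openConn a₀ b), hdec ((openConn a₀ b)ᶜ ∩ (⋃ s ∈ S, openConn a₀ s) ∩ (⋃ s ∈ S, openConn s b)),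
    hdec (⋃ s ∈ S, openConn s b), hsum]
  have h0' := mul_le_mul_of_nonneg_left h0 (sub_nonneg.2 hp1)
  have h1' := mul_le_mul_of_nonneg_left h1 hp0
  nlinarith [h0', h1']

/-- **Corner expansion of the block kernel over a finite set of pairs.**  For a non-empty block `S` and a finite set `F`
of pairs: if the block-kernel inequality (fixed `A, S, b, a₀, sel`) holds for every weighting `u'` that agrees with `u`
off `F` and takes only the values `0, 1` on `F`, then it holds for `u`.  Induction on `F` by `blockKernel_of_update`.
[cite: KozmaNitzan2024, §5.3 p. 34 (linearity in one edge weight)] -/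
theorem blockKernel_of_zeroOne_on (u : Sym2 (Fin n) → unitInterval) (A S : Finset (Fin n)) (b a₀ : Fin n)
    (sel : Finset (Fin n) → Fin n) (F : Finset (Sym2 (Fin n))) (hS : S.Nonempty)
    (h : ∀ u' : Sym2 (Fin n) → unitInterval, (∀ e, e ∉ F → u' e = u e) → (∀ e ∈ F, u' e = 0 ∨ u' e = 1) →
      (prodBernoulli u').real (openConn a₀ b)
          + (prodBernoulli u').real ((openConn a₀ b)ᶜ ∩ (⋃ s ∈ S, openConn a₀ s) ∩ (⋃ s ∈ S, openConn s b))
        ≤ (prodBernoulli u').real (⋃ s ∈ S, openConn s b)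
          + ∑ W ∈ (Finset.univ : Finset (Finset (Fin n))).filter (fun W => Disjoint W A),
              (prodBernoulli u').real {ω : BondConfig (Fin n) | ∀ z : Fin n, (z ∈ W ↔ ω ∈ ⋃ s ∈ S, openConn s z)}
                * (prodBernoulli u').real (openConnIn ((W : Set (Fin n))ᶜ) (sel W) b)) :
    (prodBernoulli u).real (openConn a₀ b)
        + (prodBernoulli u).real ((openConn a₀ b)ᶜ ∩ (⋃ s ∈ S, openConn a₀ s) ∩ (⋃ s ∈ S, openConn s b))
      ≤ (prodBernoulli u).real (⋃ s ∈ S, openConn s b)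
        + ∑ W ∈ (Finset.univ : Finset (Finset (Fin n))).filter (fun W => Disjoint W A),
            (prodBernoulli u).real {ω : BondConfig (Fin n) | ∀ z : Fin n, (z ∈ W ↔ ω ∈ ⋃ s ∈ S, openConn s z)}
              * (prodBernoulli u).real (openConnIn ((W : Set (Fin n))ᶜ) (sel W) b) := by
  induction F using Finset.induction_on generalizing u with
  | empty => exact h u (fun _ _ => rfl) (fun _ he => absurd he (Finset.notMem_empty _))
  | insert e F heF ih =>
    refine blockKernel_of_update u A S b a₀ sel e hS ?_ ?_
    · refine ih (Function.update u e 1) fun u' hu' h01 => h u' (fun e' he' => ?_) (fun e' he' => ?_)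
      · rw [hu' e' fun h' => he' (Finset.mem_insert_of_mem h'),
          Function.update_of_ne (show e' ≠ e from fun h' => he' (h'.symm ▸ Finset.mem_insert_self e F))]
      · rcases Finset.mem_insert.1 he' with rfl | he''
        · exact Or.inr (by rw [hu' _ heF, Function.update_self])
        · exact h01 e' he''
    · refine ih (Function.update u e 0) fun u' hu' h01 => h u' (fun e' he' => ?_) (fun e' he' => ?_)
      · rw [hu' e' fun h' => he' (Finset.mem_insert_of_mem h'),
          Function.update_of_ne (show e' ≠ e from fun h' => he' (h'.symm ▸ Finset.mem_insert_self e F))]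
      · rcases Finset.mem_insert.1 he' with rfl | he''
        · exact Or.inl (by rw [hu' _ heF, Function.update_self])
        · exact h01 e' he''

/-- **Initial segment (monotonicity of the block kernel in the designated relay).**  The left side of the block kernel
is the glued two-point function `μ_{u/S}(a₀ ↔ b)` (`blockGrowth_glue_real_openConn`) and the right side does not mention
`a₀`; so the kernel at a designated relay `a'` gives it at every `a₀` with `μ_{u/S}(a₀ ↔ b) ≤ μ_{u/S}(a' ↔ b)`.
[cite: KozmaNitzan2024, §3.2 (Definition p. 12)] -/
theorem blockKernel_mono_designated (u : Sym2 (Fin n) → unitInterval) (A S : Finset (Fin n)) (b a₀ a' : Fin n)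
    (sel : Finset (Fin n) → Fin n)
    (hle : (prodBernoulli (fun e : Sym2 (Fin n) => if (∀ x ∈ e, x ∈ S) ∧ ¬ e.IsDiag then 1 else u e)).real (openConn a₀ b) ≤
      (prodBernoulli (fun e : Sym2 (Fin n) => if (∀ x ∈ e, x ∈ S) ∧ ¬ e.IsDiag then 1 else u e)).real (openConn a' b))
    (h : (prodBernoulli u).real (openConn a' b)
          + (prodBernoulli u).real ((openConn a' b)ᶜ ∩ (⋃ s ∈ S, openConn a' s) ∩ (⋃ s ∈ S, openConn s b))
        ≤ (prodBernoulli u).real (⋃ s ∈ S, openConn s b)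
          + ∑ W ∈ (Finset.univ : Finset (Finset (Fin n))).filter (fun W => Disjoint W A),
              (prodBernoulli u).real {ω : BondConfig (Fin n) | ∀ z : Fin n, (z ∈ W ↔ ω ∈ ⋃ s ∈ S, openConn s z)}
                * (prodBernoulli u).real (openConnIn ((W : Set (Fin n))ᶜ) (sel W) b)) :
    (prodBernoulli u).real (openConn a₀ b)
        + (prodBernoulli u).real ((openConn a₀ b)ᶜ ∩ (⋃ s ∈ S, openConn a₀ s) ∩ (⋃ s ∈ S, openConn s b))
      ≤ (prodBernoulli u).real (⋃ s ∈ S, openConn s b)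
        + ∑ W ∈ (Finset.univ : Finset (Finset (Fin n))).filter (fun W => Disjoint W A),
            (prodBernoulli u).real {ω : BondConfig (Fin n) | ∀ z : Fin n, (z ∈ W ↔ ω ∈ ⋃ s ∈ S, openConn s z)}
              * (prodBernoulli u).real (openConnIn ((W : Set (Fin n))ᶜ) (sel W) b) := by
  rw [blockGrowth_glue_real_openConn, blockGrowth_glue_real_openConn] at hle
  exact hle.trans h

/-- **The switching leaf.**  Let `g = u/S` be the glued weighting and `s₀ ∈ S`.  If the engine (designated-goodness)
inequality of the glued quadruple `(g, A, s₀, b)` holds at some relay `a'`,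
`μ_g(a' ↔ b) ≤ μ_g(s₀ ↔ b) + Σ_{W ∋ s₀, W ∩ A = ∅} μ_g(C(s₀) = W) · μ_g(sel W ↔ b in Wᶜ)`, and `μ_g(a₀ ↔ b) ≤ μ_g(a' ↔ b)`,
then the block kernel of the UN-glued graph holds at `a₀`: the glued point pockets of `s₀` are the block pockets
(`glue_preimage_pointPocket`), the avoiding connection does not see the gluing, and the left side is `μ_g(a₀ ↔ b)`.
This is the leaf by which goodness of the glued block OBSERVED FROM ONE OF ITS OWN VERTICES (designated as that
observer's induction hypothesis dictates) closes instances of the residual kernel. [cite: KozmaNitzan2024, §3.2 (proof of Thm 5, p. 14)] -/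
theorem blockKernel_of_designated (u : Sym2 (Fin n) → unitInterval) (A S : Finset (Fin n)) (b a₀ a' s₀ : Fin n)
    (sel : Finset (Fin n) → Fin n) (hs₀ : s₀ ∈ S)
    (hle : (prodBernoulli (fun e : Sym2 (Fin n) => if (∀ x ∈ e, x ∈ S) ∧ ¬ e.IsDiag then 1 else u e)).real (openConn a₀ b) ≤
      (prodBernoulli (fun e : Sym2 (Fin n) => if (∀ x ∈ e, x ∈ S) ∧ ¬ e.IsDiag then 1 else u e)).real (openConn a' b))
    (hdes : (prodBernoulli (fun e : Sym2 (Fin n) => if (∀ x ∈ e, x ∈ S) ∧ ¬ e.IsDiag then 1 else u e)).real (openConn a' b) ≤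
      (prodBernoulli (fun e : Sym2 (Fin n) => if (∀ x ∈ e, x ∈ S) ∧ ¬ e.IsDiag then 1 else u e)).real (openConn s₀ b)
        + ∑ W ∈ (Finset.univ : Finset (Finset (Fin n))).filter (fun W => s₀ ∈ W ∧ Disjoint W A),
            (prodBernoulli (fun e : Sym2 (Fin n) => if (∀ x ∈ e, x ∈ S) ∧ ¬ e.IsDiag then 1 else u e)).real
                {ω : BondConfig (Fin n) | openCluster ω s₀ = (W : Set (Fin n))}
              * (prodBernoulli (fun e : Sym2 (Fin n) => if (∀ x ∈ e, x ∈ S) ∧ ¬ e.IsDiag then 1 else u e)).real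
                  (openConnIn ((W : Set (Fin n))ᶜ) (sel W) b)) :
    (prodBernoulli u).real (openConn a₀ b)
        + (prodBernoulli u).real ((openConn a₀ b)ᶜ ∩ (⋃ s ∈ S, openConn a₀ s) ∩ (⋃ s ∈ S, openConn s b))
      ≤ (prodBernoulli u).real (⋃ s ∈ S, openConn s b)
        + ∑ W ∈ (Finset.univ : Finset (Finset (Fin n))).filter (fun W => Disjoint W A),
            (prodBernoulli u).real {ω : BondConfig (Fin n) | ∀ z : Fin n, (z ∈ W ↔ ω ∈ ⋃ s ∈ S, openConn s z)}
              * (prodBernoulli u).real (openConnIn ((W : Set (Fin n))ᶜ) (sel W) b) := by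
  set g : Sym2 (Fin n) → unitInterval := fun e => if (∀ x ∈ e, x ∈ S) ∧ ¬ e.IsDiag then 1 else u e with hg
  -- left side and the block's reach, un-glued
  rw [← blockGrowth_glue_real_openConn, ← blockGrowth_glue_real_iUnion u S b]
  have hreach : (prodBernoulli g).real (openConn s₀ b) ≤ (prodBernoulli g).real (⋃ s ∈ S, openConn s b) :=
    measureReal_mono (fun ω hω => Set.mem_iUnion₂.2 ⟨s₀, hs₀, hω⟩) (measure_ne_top _ _)
  -- the point pocket of `s₀` in `g`, written through the connections from `s₀`
  have hset : ∀ W : Finset (Fin n), s₀ ∈ W →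
      {ω : BondConfig (Fin n) | openCluster ω s₀ = (W : Set (Fin n))} =
        {ω : BondConfig (Fin n) | ∀ x : Fin n, (x ∈ W ↔ ω ∈ openConn s₀ x)} := by
    intro W hW
    ext ω
    simp only [Set.mem_setOf_eq]
    rw [goodStep24_cluster_eq_iff ω s₀ W hW]
    refine ⟨fun h x => ?_, fun h x _ => h x⟩
    by_cases hx : x = s₀
    · subst hx
      exact ⟨fun _ => (SimpleGraph.Reachable.refl x : (openGraph ω).Reachable x x), fun _ => hW⟩
    · exact h x hx
  -- termwise comparison of the pockets
  have hterm : ∀ W ∈ (Finset.univ : Finset (Finset (Fin n))).filter (fun W => s₀ ∈ W ∧ Disjoint W A),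
      (prodBernoulli g).real {ω : BondConfig (Fin n) | openCluster ω s₀ = (W : Set (Fin n))}
        * (prodBernoulli g).real (openConnIn ((W : Set (Fin n))ᶜ) (sel W) b) ≤
      (prodBernoulli u).real {ω : BondConfig (Fin n) | ∀ z : Fin n, (z ∈ W ↔ ω ∈ ⋃ s ∈ S, openConn s z)}
        * (prodBernoulli u).real (openConnIn ((W : Set (Fin n))ᶜ) (sel W) b) := by
    intro W hW
    have hW' : s₀ ∈ W := (Finset.mem_filter.1 hW).2.1
    have e1 : (prodBernoulli g).real {ω : BondConfig (Fin n) | openCluster ω s₀ = (W : Set (Fin n))} =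
        (prodBernoulli u).real {ω : BondConfig (Fin n) | ∀ z : Fin n, (z ∈ W ↔ ω ∈ ⋃ s ∈ S, openConn s z)} := by
      rw [hset W hW', hg, stub_gluePushforward n u S, glue_preimage_pointPocket S W s₀ hs₀]
    by_cases hSW : S ⊆ W
    · have e2 : (prodBernoulli g).real (openConnIn ((W : Set (Fin n))ᶜ) (sel W) b) =
          (prodBernoulli u).real (openConnIn ((W : Set (Fin n))ᶜ) (sel W) b) := by
        refine prodBernoulli_real_eq_of_determinedBy g u (F := ((W : Set (Fin n))ᶜ).sym2) (fun e he => ?_)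
          (DCT16.determinedBy_openConnIn _ (sel W) b subset_rfl) MeasurableSet.of_discrete
        simp only [hg]
        rw [if_neg]
        rintro ⟨hall, hdiag⟩
        induction e using Sym2.ind with
        | h x y =>
          have hx : x ∉ (W : Set (Fin n)) := (Set.mk_mem_sym2_iff.1 he).1
          exact hx (Finset.mem_coe.2 (hSW (hall x (Sym2.mem_mk_left x y))))
      rw [e1, e2]
    · obtain ⟨s₁, hs₁S, hs₁W⟩ := Finset.not_subset.1 hSW
      rw [e1, blockPocket_eq_empty S W s₁ hs₁S hs₁W, measureReal_empty, zero_mul, zero_mul]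
  -- the pockets of `s₀` containing `s₀` are among all dead pockets
  have hsub : (Finset.univ : Finset (Finset (Fin n))).filter (fun W => s₀ ∈ W ∧ Disjoint W A) ⊆
      (Finset.univ : Finset (Finset (Fin n))).filter (fun W => Disjoint W A) := by
    intro W hW
    exact Finset.mem_filter.2 ⟨Finset.mem_univ _, (Finset.mem_filter.1 hW).2.2⟩
  have hsum : ∑ W ∈ (Finset.univ : Finset (Finset (Fin n))).filter (fun W => s₀ ∈ W ∧ Disjoint W A),
        (prodBernoulli g).real {ω : BondConfig (Fin n) | openCluster ω s₀ = (W : Set (Fin n))}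
          * (prodBernoulli g).real (openConnIn ((W : Set (Fin n))ᶜ) (sel W) b) ≤
      ∑ W ∈ (Finset.univ : Finset (Finset (Fin n))).filter (fun W => Disjoint W A),
        (prodBernoulli u).real {ω : BondConfig (Fin n) | ∀ z : Fin n, (z ∈ W ↔ ω ∈ ⋃ s ∈ S, openConn s z)}
          * (prodBernoulli u).real (openConnIn ((W : Set (Fin n))ᶜ) (sel W) b) :=
    (Finset.sum_le_sum hterm).trans (Finset.sum_le_sum_of_subset_of_nonneg hsub fun _ _ _ =>
      mul_nonneg measureReal_nonneg measureReal_nonneg)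
  linarith [hle, hdes, hreach, hsum]

end BlockKernelMix

open Literature.Probability.LatticeModels Literature.Probability.Percolation in
/-- Registered helper stub `stub_blockKernelEdgeMix_xfa` (invested seat xfam-a): the block kernel with a fixed selection is
affine in the weight of ANY pair, so it follows from its two endpoint instances (= `blockKernel_of_update`).
[cite: KozmaNitzan2024, §5.3 p. 34] -/
theorem stub_blockKernelEdgeMix_xfa : ∀ (n : ℕ) (u : Sym2 (Fin n) → unitInterval) (A S : Finset (Fin n)) (b a₀ : Fin n) (sel : Finset (Fin n) → Fin n) (e : Sym2 (Fin n)), S.Nonempty → ((prodBernoulli (Function.update u e 1)).real (openConn a₀ b) + (prodBernoulli (Function.update u e 1)).real ((openConn a₀ b)ᶜ ∩ (⋃ s ∈ S, openConn a₀ s) ∩ (⋃ s ∈ S, openConn s b)) ≤ (prodBernoulli (Function.update u e 1)).real (⋃ s ∈ S, openConn s b) + ∑ W ∈ (Finset.univ : Finset (Finset (Fin n))).filter (fun W => Disjoint W A), (prodBernoulli (Function.update u e 1)).real {ω : BondConfig (Fin n) | ∀ z : Fin n, (z ∈ W ↔ ω ∈ ⋃ s ∈ S, openConn s z)} * (prodBernoulli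 (Function.update u e 1)).real (openConnIn ((W : Set (Fin n))ᶜ) (sel W) b)) → ((prodBernoulli (Function.update u e 0)).real (openConn a₀ b) + (prodBernoulli (Function.update u e 0)).real ((openConn a₀ b)ᶜ ∩ (⋃ s ∈ S, openConn a₀ s) ∩ (⋃ s ∈ S, openConn s b)) ≤ (prodBernoulli (Function.update u e 0)).real (⋃ s ∈ S, openConn s b) + ∑ W ∈ (Finset.univ : Finset (Finset (Fin n))).filter (fun W => Disjoint W A), (prodBernoulli (Function.update u e 0)).real {ω : BondConfig (Fin n) | ∀ z : Fin n, (z ∈ W ↔ ω ∈ ⋃ s ∈ S, openConn s z)} * (prodBernoulli (Function.update u e 0)).real (openConnIn ((W : Set (Fin n))ᶜ) (sel W) b)) → (prodBernoulli u).real (openConn a₀ b) + (prodBernoulli u).real ((openConn a₀ b)ᶜ ∩ (⋃ s ∈ S, openConn a₀ s) ∩ (⋃ s ∈ S, openConn s b)) ≤ (prodBernoulli u).real (⋃ s ∈ S, openConn s b) + ∑ W ∈ (Finset.univ : Finset (Finset (Fin n))).filter (fun W => Disjoint W A), (prodBernoulli u).real {ω : BondConfig (Fin n) | ∀ z : Fin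 n, (z ∈ W ↔ ω ∈ ⋃ s ∈ S, openConn s z)} * (prodBernoulli u).real (openConnIn ((W : Set (Fin n))ᶜ) (sel W) b) :=
  fun _ u A S b a₀ sel e hS h1 h0 => blockKernel_of_update u A S b a₀ sel e hS h1 h0

open Literature.Probability.LatticeModels Literature.Probability.Percolation in
/-- Registered helper stub `stub_blockKernelCorners_xfa` (invested seat xfam-a): corner expansion of the block kernel over a
finite set of pairs (= `blockKernel_of_zeroOne_on`). [cite: KozmaNitzan2024, §5.3 p. 34] -/
theorem stub_blockKernelCorners_xfa : ∀ (n : ℕ) (u : Sym2 (Fin n) → unitInterval) (A S : Finset (Fin n)) (b a₀ : Fin n) (sel : Finset (Fin n) → Fin n) (F : Finset (Sym2 (Fin n))), S.Nonempty → (∀ u' : Sym2 (Fin n) → unitInterval, (∀ e, e ∉ F → u' e = u e) → (∀ e ∈ F, u' e = 0 ∨ u' e = 1) → (prodBernoulli u').real (openConn a₀ b) + (prodBernoulli u').real ((openConn a₀ b)ᶜ ∩ (⋃ s ∈ S, openConn a₀ s) ∩ (⋃ s ∈ S, openConn s b)) ≤ (prodBernoulli u').real (⋃ s ∈ S, openConn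 s b) + ∑ W ∈ (Finset.univ : Finset (Finset (Fin n))).filter (fun W => Disjoint W A), (prodBernoulli u').real {ω : BondConfig (Fin n) | ∀ z : Fin n, (z ∈ W ↔ ω ∈ ⋃ s ∈ S, openConn s z)} * (prodBernoulli u').real (openConnIn ((W : Set (Fin n))ᶜ) (sel W) b)) → (prodBernoulli u).real (openConn a₀ b) + (prodBernoulli u).real ((openConn a₀ b)ᶜ ∩ (⋃ s ∈ S, openConn a₀ s) ∩ (⋃ s ∈ S, openConn s b)) ≤ (prodBernoulli u).real (⋃ s ∈ S, openConn s b) + ∑ W ∈ (Finset.univ : Finset (Finset (Fin n))).filter (fun W => Disjoint W A), (prodBernoulli u).real {ω : BondConfig (Fin n) | ∀ z : Fin n, (z ∈ W ↔ ω ∈ ⋃ s ∈ S, openConn s z)} * (prodBernoulli u).real (openConnIn ((W : Set (Fin n))ᶜ) (sel W) b) :=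
  fun _ u A S b a₀ sel F hS h => blockKernel_of_zeroOne_on u A S b a₀ sel F hS h

open Literature.Probability.LatticeModels Literature.Probability.Percolation in
/-- Registered helper stub `stub_blockKernelSwitchLeaf_xfa` (invested seat xfam-a): the switching leaf — designated goodness
of the glued block observed from one of its vertices, at a relay at least as `u/S`-reliable as `a₀`, gives the block kernel
at `a₀` (= `blockKernel_of_designated`). [cite: KozmaNitzan2024, §3.2 (proof of Thm 5, p. 14)] -/
theorem stub_blockKernelSwitchLeaf_xfa : ∀ (n : ℕ) (u : Sym2 (Fin n) → unitInterval) (A S : Finset (Fin n)) (b a₀ a' s₀ : Fin n) (sel : Finset (Fin n) → Fin n), s₀ ∈ S → (prodBernoulli (fun e : Sym2 (Fin n) => if (∀ x ∈ e, x ∈ S) ∧ ¬ e.IsDiag then 1 else u e)).real (openConn a₀ b) ≤ (prodBernoulli (fun e : Sym2 (Fin n) => if (∀ x ∈ e, x ∈ S) ∧ ¬ e.IsDiag then 1 else u e)).real (openConn a' b) → (prodBernoulli (fun e : Sym2 (Fin n) => if (∀ x ∈ e, x ∈ S) ∧ ¬ e.IsDiag then 1 else u e)).real (openConn a' b) ≤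 (prodBernoulli (fun e : Sym2 (Fin n) => if (∀ x ∈ e, x ∈ S) ∧ ¬ e.IsDiag then 1 else u e)).real (openConn s₀ b) + ∑ W ∈ (Finset.univ : Finset (Finset (Fin n))).filter (fun W => s₀ ∈ W ∧ Disjoint W A), (prodBernoulli (fun e : Sym2 (Fin n) => if (∀ x ∈ e, x ∈ S) ∧ ¬ e.IsDiag then 1 else u e)).real {ω : BondConfig (Fin n) | openCluster ω s₀ = (W : Set (Fin n))} * (prodBernoulli (fun e : Sym2 (Fin n) => if (∀ x ∈ e, x ∈ S) ∧ ¬ e.IsDiag then 1 else u e)).real (openConnIn ((W : Set (Fin n))ᶜ) (sel W) b) → (prodBernoulli u).real (openConn a₀ b) + (prodBernoulli u).real ((openConn a₀ b)ᶜ ∩ (⋃ s ∈ S, openConn a₀ s) ∩ (⋃ s ∈ S, openConn s b)) ≤ (prodBernoulli u).real (⋃ s ∈ S, openConn s b) + ∑ W ∈ (Finset.univ : Finset (Finset (Fin n))).filter (fun W => Disjoint W A), (prodBernoulli u).real {ω : BondConfig (Fin n) | ∀ z : Fin n, (z ∈ W ↔ ω ∈ ⋃ s ∈ S, openConn s z)}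 * (prodBernoulli u).real (openConnIn ((W : Set (Fin n))ᶜ) (sel W) b) :=
  fun _ u A S b a₀ a' s₀ sel hs₀ hle hdes => blockKernel_of_designated u A S b a₀ a' s₀ sel hs₀ hle hdes

end

end Summit.CriticalPhenomena.PercolationContinuityZ3.Theorems
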